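import Summits.Ventures.LatticeQCDFlow.Scaling.DoeblinHotSeparation

/-!
HONEST FRAMING: exact (Metropolis-corrected) sampling algorithms for lattice gauge theory; figures
of merit are autocorrelation/cost numbers at stated couplings and volumes; no continuum-physics
claim.

# DoeblinHotTimeAverages — THE HONEST `(ε, η)` SAMPLE SIZE SURVIVES A DOEBLIN-MINORISED HOT SAMPLER: `γ ≥ tcp/(2m)`,
# AND FROM EVERY START A BURN-IN `⌈(2m/(tcp))·log((2K+p)/(pε/2))⌉` PLUS `N ≥ (4Var_π̃(f)/(η²ε))·(2m/(tcp))` SAMPLES GIVE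
# `P_x{|N⁻¹Σ_{s<N} f(X_{r+s}) − E_π̃ f| ≥ η} ≤ ε` — ONCE `4t ≤ p(1−t)·a·w_0` (lean-2 GEN-27, ours)

Venture-side (OURS).  Cell `lqcd-flow` (pub-lqcd), unit `pub-lqcd-lean-2-g27`, 2026-08-27.  Doeblin-minorised hot
samplers, file 11 — `Scaling/DominatedStarTimeAverages` with the hot sampler of `Scaling/DoeblinHotSampler`
(`μ_k`-reversible single-site kernels, `M_0(u,·) ≥ a·μ_0(·)`, `0 < a ≤ 1`; hub list with multiplicities `≥ c`,
one-sided domination `p·μ_{l_r}(φ_r u) ≤ μ_0(u)`, `0 < p ≤ 1`; `|S| ≥ 2`).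

## What is proved

* **`doeblinStar_spectralGap_ge`** — the variational gap `γ ≥ γ⋆ ≥ tcp/(2m)`; **`doeblinStar_spectralGap_inv_le`** —
  `γ⁻¹ ≤ 2m/(tcp)`.
* **`doeblinStar_timeAverage`** — Levin–Peres–Wilmer Thm 12.21 for the scheme: `r ≥ ⌈(2m/(tcp))·log((2K+p)/(p·(ε/2)))⌉`,
  `N ≥ 1`, `N ≥ (4Var_π̃(f)/(η²ε))·(2m/(tcp))` ⇒ `P_x{|N⁻¹Σ_{s<N} f(X_{r+s}) − E_π̃ f| ≥ η} ≤ ε` for every start `x`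
  (the `pathSum`-form of the tree's `LevinPeres2017_thm_12_21`).

Reading (no numerics implied): effective-sample-size honesty for the realistic hot level — the burn-in and the
sample size of chapter M hold verbatim for a Metropolised-flow hot kernel with acceptance floor `a`, the only change
being the regime `4t ≤ p(1−t)·a·w_0`.  NOT CLAIMED: anything without the minorisation; anything measured.  Literature
grade (cell rule): OWN COMPOSITION; Levin–Peres–Wilmer Thm 12.21 ∕ Lemma 13.x are the tree's typed statements used
as lemmas; nothing new cited; no new bib keys.
-/

noncomputable section

open Finset Function
open Literature.Probability.MarkovChains

namespace Summit.Ventures.LatticeQCDFlow.Scaling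

variable {S : Type*} [Fintype S] [DecidableEq S] {K m : ℕ} {μ : Fin (K + 1) → S → ℝ} {M : Fin (K + 1) → S → S → ℝ}
  {w : Fin (K + 1) → ℝ} {t p a : ℝ}

section Avg
variable (κ : Fin m → Fin K) (φ : Fin m → Equiv.Perm S)

/-- **THE VARIATIONAL SPECTRAL GAP WITH A DOEBLIN-MINORISED HOT SAMPLER: `γ ≥ tcp/(2m)`** (`|S| ≥ 2`, `0 < t`,
reversible kernels, `4t ≤ p(1−t)·a·w_0`). [ours] -/
theorem doeblinStar_spectralGap_ge [Nontrivial S] (hm : 1 ≤ m) (ht0 : 0 < t) (ht1 : t ≤ 1) (hw0 : ∀ k, 0 ≤ w k)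
    (hw1 : ∑ k, w k = 1) (hμ : ∀ k x, 0 < μ k x) (hμ1 : ∀ k, ∑ u, μ k u = 1) (hM : ∀ k, IsRowStochastic (M k))
    (hMrev : ∀ k, DetailedBalance (μ k) (M k)) (ha0 : 0 < a) (ha1 : a ≤ 1) (hmin : ∀ u v, a * μ 0 v ≤ M 0 u v)
    (hp0 : 0 < p) (hp1 : p ≤ 1) (hdom : ∀ r u, p * μ (κ r).succ (φ r u) ≤ μ 0 u)
    (hreg : 4 * t ≤ p * (1 - t) * (a * w 0))
    {c : ℕ} (hc1 : 1 ≤ c) (hc : ∀ p' : Fin K, c ≤ (univ.filter (fun r : Fin m => κ r = p')).card) (hcm : c ≤ m) :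
    t * c * p / (2 * m) ≤ spectralGap (tensorFun μ) (fun y z : Fin (K + 1) → S =>
        t * ptGraphSwap μ (fun r : Fin m => (((0 : Fin (K + 1)), (κ r).succ) : Fin (K + 1) × Fin (K + 1))) φ y z
          + (1 - t) * prodKernel w M y z) := by
  have hP := weightedScheme_isRowStochastic (t := t) (w := w)
    (ptGraphSwap_isRowStochastic (e := fun r : Fin m => (((0 : Fin (K + 1)), (κ r).succ) : Fin (K + 1) × Fin (K + 1)))
      (φ := φ) hμ) hM hw0 hw1 ht0.le ht1
  exact (doeblinStar_absSpectralGap_ge κ φ hm ht0.le ht1 hw0 hw1 hμ hμ1 hM hMrev ha0 ha1 hmin hp0 hp1 hdom hreg hc1 hc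
    hcm).trans
    (absSpectralGap_le_spectralGap (fun z => tensorFun_pos hμ z) (sum_tensorFun_eq_one _ hμ1) hP
      (dominatedStar_detailedBalance κ φ hμ hMrev)
      (doeblinStar_isIrreducible κ φ hm ht0 ht1 hw0 hw1 hμ hμ1 hM hMrev ha0 ha1 hmin hp0 hp1 hdom hreg hc1 hc hcm))

/-- **`γ⁻¹ ≤ 2m/(tcp)`** with a Doeblin-minorised hot sampler (`|S| ≥ 2`). [ours] -/
theorem doeblinStar_spectralGap_inv_le [Nontrivial S] (hm : 1 ≤ m) (ht0 : 0 < t) (ht1 : t ≤ 1) (hw0 : ∀ k, 0 ≤ w k)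
    (hw1 : ∑ k, w k = 1) (hμ : ∀ k x, 0 < μ k x) (hμ1 : ∀ k, ∑ u, μ k u = 1) (hM : ∀ k, IsRowStochastic (M k))
    (hMrev : ∀ k, DetailedBalance (μ k) (M k)) (ha0 : 0 < a) (ha1 : a ≤ 1) (hmin : ∀ u v, a * μ 0 v ≤ M 0 u v)
    (hp0 : 0 < p) (hp1 : p ≤ 1) (hdom : ∀ r u, p * μ (κ r).succ (φ r u) ≤ μ 0 u)
    (hreg : 4 * t ≤ p * (1 - t) * (a * w 0))
    {c : ℕ} (hc1 : 1 ≤ c) (hc : ∀ p' : Fin K, c ≤ (univ.filter (fun r : Fin m => κ r = p')).card) (hcm : c ≤ m) :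
    (spectralGap (tensorFun μ) (fun y z : Fin (K + 1) → S =>
        t * ptGraphSwap μ (fun r : Fin m => (((0 : Fin (K + 1)), (κ r).succ) : Fin (K + 1) × Fin (K + 1))) φ y z
          + (1 - t) * prodKernel w M y z))⁻¹ ≤ 2 * m / (t * c * p) := by
  have hmpos : (0 : ℝ) < m := Nat.cast_pos.mpr (by omega)
  have hcpos : (0 : ℝ) < c := Nat.cast_pos.mpr (by omega)
  have hpos : 0 < t * c * p / (2 * m) := by positivity
  have h := inv_anti₀ hpos (doeblinStar_spectralGap_ge κ φ hm ht0 ht1 hw0 hw1 hμ hμ1 hM hMrev ha0 ha1 hmin hp0 hp1 hdom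
    hreg hc1 hc hcm)
  rwa [inv_div] at h

/-- **THE SAMPLE-SIZE RULE WITH A DOEBLIN-MINORISED HOT SAMPLER** (`|S| ≥ 2`): for every observable `f` and `ε, η > 0`,
a burn-in `r ≥ ⌈(2m/(tcp))·log((2K+p)/(p·(ε/2)))⌉` and `N ≥ 1` samples with `N ≥ (4Var_π̃(f)/(η²ε))·(2m/(tcp))` give,
from EVERY start `x`, **`P_x{|N⁻¹ Σ_{s<N} f(X_{r+s}) − E_π̃(f)| ≥ η} ≤ ε`**. [ours] -/
theorem doeblinStar_timeAverage [Nontrivial S] (hm : 1 ≤ m) (ht0 : 0 < t) (ht1 : t ≤ 1) (hw0 : ∀ k, 0 ≤ w k)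
    (hw1 : ∑ k, w k = 1) (hμ : ∀ k x, 0 < μ k x) (hμ1 : ∀ k, ∑ u, μ k u = 1) (hM : ∀ k, IsRowStochastic (M k))
    (hMrev : ∀ k, DetailedBalance (μ k) (M k)) (ha0 : 0 < a) (ha1 : a ≤ 1) (hmin : ∀ u v, a * μ 0 v ≤ M 0 u v)
    (hp0 : 0 < p) (hp1 : p ≤ 1) (hdom : ∀ r u, p * μ (κ r).succ (φ r u) ≤ μ 0 u)
    (hreg : 4 * t ≤ p * (1 - t) * (a * w 0))
    {c : ℕ} (hc1 : 1 ≤ c) (hc : ∀ p' : Fin K, c ≤ (univ.filter (fun r : Fin m => κ r = p')).card) (hcm : c ≤ m)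
    (f : (Fin (K + 1) → S) → ℝ) {ε η : ℝ} (hε : 0 < ε) (hη : 0 < η) {r N : ℕ}
    (hr : ⌈2 * (m : ℝ) / (t * c * p) * Real.log ((2 * (K : ℝ) + p) / (p * (ε / 2)))⌉₊ ≤ r) (hN : 0 < N)
    (hNvar : 4 * lawVariance (tensorFun μ) f / (η ^ 2 * ε) * (2 * m / (t * c * p)) ≤ N) (x : Fin (K + 1) → S) :
    pathSum (fun y z : Fin (K + 1) → S =>
        t * ptGraphSwap μ (fun r : Fin m => (((0 : Fin (K + 1)), (κ r).succ) : Fin (K + 1) × Fin (K + 1))) φ y z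
          + (1 - t) * prodKernel w M y z) (N + r) x (fun ω =>
        if η ≤ |(∑ s : Fin N, f ((Matrix.vecCons x ω : Fin (N + r + 1) → (Fin (K + 1) → S))
              ⟨(s : ℕ) + r, by have := s.isLt; omega⟩)) / N - lawMean (tensorFun μ) f|
          then (1 : ℝ) else 0) ≤ ε := by
  have hstat : ∀ (k : Fin (K + 1)) (v : S), ∑ u, μ k u * M k u v = μ k v := fun k v => (hMrev k).isStationary (hM k).2 v
  have hmpos : (0 : ℝ) < m := Nat.cast_pos.mpr (by omega)
  have hcpos : (0 : ℝ) < c := Nat.cast_pos.mpr (by omega)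
  have hcm' : (c : ℝ) ≤ m := by exact_mod_cast hcm
  have hP := weightedScheme_isRowStochastic (t := t) (w := w)
    (ptGraphSwap_isRowStochastic (e := fun r : Fin m => (((0 : Fin (K + 1)), (κ r).succ) : Fin (K + 1) × Fin (K + 1)))
      (φ := φ) hμ) hM hw0 hw1 ht0.le ht1
  have hDB := dominatedStar_detailedBalance κ φ (t := t) (w := w) hμ hMrev
  have hirr := doeblinStar_isIrreducible κ φ hm ht0 ht1 hw0 hw1 hμ hμ1 hM hMrev ha0 ha1 hmin hp0 hp1 hdom hreg hc1 hc hcm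
  have hε2 : 0 < ε / 2 := by linarith
  -- `d(⌈…⌉) ≤ ε/2`
  have ht₀ : worstTvDist (fun y z : Fin (K + 1) → S =>
      t * ptGraphSwap μ (fun r : Fin m => (((0 : Fin (K + 1)), (κ r).succ) : Fin (K + 1) × Fin (K + 1))) φ y z
        + (1 - t) * prodKernel w M y z) (tensorFun μ)
      ⌈2 * (m : ℝ) / (t * c * p) * Real.log ((2 * (K : ℝ) + p) / (p * (ε / 2)))⌉₊ ≤ ε / 2 := by
    refine (doeblinStar_worstTvDist_le κ φ hm ht0.le ht1 hw0 hw1 hμ hμ1 hM hstat ha0 ha1 hmin hp0 hp1 hdom hreg hc1 hc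
      hcm _).trans ?_
    have hq0 : 0 < t * c * p / (2 * m) := by positivity
    have hq1 : t * c * p / (2 * m) ≤ 1 := by
      rw [div_le_one (by positivity)]
      have h1 : t * c ≤ 1 * m := by nlinarith
      nlinarith
    have hC : 0 < (2 * (K : ℝ) + p) / p := by positivity
    refine geom_le_of_ge_log hq0 hq1 hC hε2 ?_
    have e1 : 1 / (t * c * p / (2 * m)) = 2 * (m : ℝ) / (t * c * p) := by field_simp
    have e2 : (2 * (K : ℝ) + p) / p / (ε / 2) = (2 * (K : ℝ) + p) / (p * (ε / 2)) := by rw [div_div]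
    rw [e1, e2]; exact Nat.le_ceil _
  have hmix := (doeblinStar_mixingTime_le κ φ hm ht0 ht1 hw0 hw1 hμ hμ1 hM hstat ha0 ha1 hmin hp0 hp1 hdom hreg hc1 hc hcm
    hε2).trans hr
  have hγ := doeblinStar_spectralGap_inv_le κ φ hm ht0 ht1 hw0 hw1 hμ hμ1 hM hMrev ha0 ha1 hmin hp0 hp1 hdom hreg hc1 hc hcm
  have hV : 0 ≤ 4 * lawVariance (tensorFun μ) f / (η ^ 2 * ε) :=
    div_nonneg (mul_nonneg (by norm_num) (lawVariance_nonneg (fun z => (tensorFun_pos hμ z).le) f)) (by positivity)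
  have hNγ : 4 * lawVariance (tensorFun μ) f / (η ^ 2 * ε) * (spectralGap (tensorFun μ)
      (fun y z : Fin (K + 1) → S =>
        t * ptGraphSwap μ (fun r : Fin m => (((0 : Fin (K + 1)), (κ r).succ) : Fin (K + 1) × Fin (K + 1))) φ y z
          + (1 - t) * prodKernel w M y z))⁻¹ ≤ N :=
    (mul_le_mul_of_nonneg_left hγ hV).trans hNvar
  exact LevinPeres2017_thm_12_21 (fun z => tensorFun_pos hμ z) (sum_tensorFun_eq_one _ hμ1) hP hDB hirr f hε hη ht₀
    hmix hN hNγ x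

end Avg

end Summit.Ventures.LatticeQCDFlow.Scaling

end
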